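import Literature.AlgebraicGeometry.Frobenioids.PerfFactorialWeakGroupSaturated
import Literature.AlgebraicGeometry.Frobenioids.PiNatPerfFactorialWeak
import Literature.AlgebraicGeometry.Frobenioids.PiNatRealificationCofinal
import Literature.AnabelianGeometry.EtaleTheta.TemperedCoverings
import Literature.AnabelianGeometry.EtaleTheta.FrdIVocabularyWeak
import Mathlib.Algebra.Group.Equiv.TypeTags
import HarnessLib

/-!
# [EtTh] Prop. 3.4 (i) for the monoids `Div⁺(Z^log_∞)` FROM Prop. 3.2 (i) — at the typed interface
# `LogDivisorModel`, in the cell's repaired reading (`treeMonoidVocabWeak.IsPerfFactorial = IsPerfFactorialCof`)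

Mochizuki, *The étale theta function and its Frobenioid-theoretic manifestations*, Publ. RIMS **45** (2009),
§3: Def. 3.1 (i) PDF p. 70 (`DIV⁺`, `Div⁺ ⊆ DIV⁺ ⊆ DIV`), Prop. 3.2 (i) p. 70 ("There exists a positive integer `n`
such that `n · DIV⁺(Z^log_∞) ⊆ Div⁺(Z^log_∞)` … a natural isomorphism `Div⁺(Z^log_∞)^pf ⥲ DIV⁺(Z^log_∞)^pf` — where
`DIV⁺(Z^log_∞)^pf` may be naturally identified with a direct product of copies of `ℚ≥0`, indexed by the cusps and
irreducible components of the special fiber"), Prop. 3.4 (i) p. 74 (printed 300) ("`Φ₀(Y^log)`, as well as each of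
the monoids `Div⁺(Z^log_∞)^{Gal(Z^log_∞/Y^log)}` appearing in the inductive limit defining `Φ₀(Y^log)`, is
perf-factorial"; proof, p. 74: "The fact that `M` is perf-factorial then follows immediately from Proposition 3.2,
(i)") [cite: MochizukiEtTh2009, Prop 3.4 p.74].

abc-iut cell, block C / W6 cone prover abc-iut-w6-d057, W6-TRANCHE-2 row **EtTh:Prop3.4(i)** (node typed by
abc-iut-L2-t3 as the field `DivisorMonoids.Prop34.isPerfFactorial` over ABSTRACT data `T : DivisorMonoids D₀`; its
docstring OMITS the clause about the individual monoids `Div⁺(Z^log_∞)^{Gal}` as "not representable on the data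
`T`").  THIS PROOF-ONLY FILE (theorems only, no definitions) gives that clause KERNEL CONTENT
at the tree's typed form of Def. 3.1 (i) / Prop. 3.2 (i), abc-iut-L2-t1/L2-t6's `LogDivisorModel`
(`TemperedCoverings.lean`: `DIVplus ≃* (Cusp ⊕ Comp → ℤ≥0)`, `Div` a subgroup of `DIV`, `Divplus = Div ⊓ DIV⁺`,
`exists_pow_mem_Divplus`), for the base member `Y = Z_∞` of the inductive system (trivial Galois group):

* `LogDivisorModel.isPerfFactorialWeak_DIVplus`, `…isZMonoprime_submonoid_primes_DIVplus`, `…rlfCofinal_DIVplus` —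
  `DIV⁺(Z^log_∞) ≅ ∏_{Cusp ⊔ Comp} ℤ≥0` is weakly perf-factorial with `ℤ`-monoprime components and cofinal
  perfection (abc-iut-L1-t2/L2-d2's `PiNat.isPerfFactorialWeak'`, `PiNat.rlf_cofinal'`, transported);
* `LogDivisorModel.isGroupSaturated_Divplus_comap`, `…mem_perfSaturation_Divplus_comap` — `Div⁺ ⊆ DIV⁺` is
  GROUP-SATURATED ([EtTh] §0 `IsGroupSaturated`; `Div` is a subgroup) and PERF-DENSE (its `perfSaturation` is all of
  `DIV⁺`: Prop. 3.2 (i), `exists_pow_mem_Divplus`);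
* **`LogDivisorModel.isPerfFactorialCof_Divplus`** — `Div⁺(Z^log_∞)` is weakly perf-factorial with cofinal
  perfection (engine `GroupSaturatedSubmonoid.isPerfFactorialWeak` / `.rlfCofinal` of
  `Frobenioids/PerfFactorialWeakGroupSaturated.lean`, then transport along `Div⁺ ∩ DIV⁺ ≅ Div⁺`), i.e.
  **`LogDivisorModel.prop34_i_Divplus : treeMonoidVocabWeak.IsPerfFactorial ↥Z.Divplus`** — [EtTh] Prop. 3.4 (i)
  for `Div⁺(Z^log_∞)` IN THE WEAK VOCABULARY OF RECORD (`FrdIVocabularyWeak.lean`), by exactly the printed route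
  "follows immediately from Proposition 3.2, (i)"; also `…isZMonoprime_submonoid_primes_Divplus` (every
  `Div⁺(Z^log_∞)_𝔭 ≅ ℤ≥0`, cf. Rmk. 3.3.1).

HONEST FRAMING / WHAT THIS IS NOT.  (1) The PRINTED notion ([FrdI] Def. 2.4 (i) with clause (d), the tree's
`IsPerfFactorial`) is NOT proved here and is REFUTED for the model shape `∏_ℕ ℤ≥0` (finding F-L2d2-1, kernel
witness `PerfFactorialProductCounterexample.not_isPerfFactorial_multiplicative_pi_nat`, p413961); the cell reads
Prop. 3.4 (i) with `treeMonoidVocabWeak` (weak + (d_cof), F-L2d2-2).  (2) Only the member `Div⁺(Z^log_∞)` itself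
(invariants under the trivial group) is treated; the Galois-invariant submonoids and the inductive limit `Φ₀(Y^log)`
(not constructed in the tree: `DivisorMonoids` records `Φ₀` as data) are not.  (3) `LogDivisorModel` is an
INTERFACE: nothing asserts that such a model arises from an actual curve; a toy inhabitant exists
(`LogDivisorModelToy.lean`).  No side is taken on [IUTchIII] Cor. 3.12; typed ≠ proved for anything else.
-/

noncomputable section

namespace Literature.AnabelianGeometry.EtaleTheta

open Literature.AlgebraicGeometry.Frobenioids Function

universe u

namespace LogDivisorModel

variable (Z : LogDivisorModel.{u})

/-! ### `DIV⁺(Z^log_∞) ≅ ∏_{Cusp ⊔ Comp} ℤ≥0` -/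

/-- `∏_{Cusp ⊔ Comp} ℤ≥0 ≅ DIV⁺(Z^log_∞)` (Def. 3.1 (i), field `divPlusEquiv`, composed with Mathlib's
`Multiplicative (J → ℕ) ≃* (J → Multiplicative ℕ)`). [cite: MochizukiEtTh2009, Def 3.1 p.70] -/
theorem nonempty_piNatEquivDIVplus : Nonempty (Multiplicative (Z.Cusp ⊕ Z.Comp → ℕ) ≃* ↥Z.DIVplus) :=
  ⟨(MulEquiv.funMultiplicative (Z.Cusp ⊕ Z.Comp) ℕ).trans Z.divPlusEquiv.symm⟩

/-- **`DIV⁺(Z^log_∞)` is weakly perf-factorial** (it is `≅ ∏ ℤ≥0`: `PiNat.isPerfFactorialWeak'` transported).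
[cite: MochizukiEtTh2009, Prop 3.2 p.70] -/
theorem isPerfFactorialWeak_DIVplus : IsPerfFactorialWeak ↥Z.DIVplus := by
  obtain ⟨e⟩ := Z.nonempty_piNatEquivDIVplus
  exact (PiNat.isPerfFactorialWeak' (J := Z.Cusp ⊕ Z.Comp)).of_mulEquiv e

/-- **The prime components `DIV⁺(Z^log_∞)_𝔮 ≅ ℤ≥0` are `ℤ`-monoprime** (primes = cusps ⊔ irreducible components,
Prop. 3.2 (i)). [cite: MochizukiEtTh2009, Prop 3.2 p.70] -/
theorem isZMonoprime_submonoid_primes_DIVplus (𝔮 : Primes ↥Z.DIVplus) : IsZMonoprime ↥𝔮.submonoid := by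
  obtain ⟨e⟩ := Z.nonempty_piNatEquivDIVplus
  exact (PiNat.isZMonoprime_submonoid_prime (Primes.congr e.symm 𝔮)).of_mulEquiv
    (Primes.submonoidCongr e (Primes.congr e.symm 𝔮) 𝔮 (Primes.congr_apply_congr_symm e 𝔮))

/-- **(d_cof) for `DIV⁺(Z^log_∞)`**: its perfection is cofinal in its realification (`PiNat.rlf_cofinal'`
transported). [cite: MochizukiEtTh2009, Lem 3.5 p.75] -/
theorem rlfCofinal_DIVplus :
    ∀ x : Z.isPerfFactorialWeak_DIVplus.Rlf, ∃ b : Perfection ↥Z.DIVplus,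
      x ∣ Z.isPerfFactorialWeak_DIVplus.toRealification b := by
  obtain ⟨e⟩ := Z.nonempty_piNatEquivDIVplus
  exact IsPerfFactorialWeak.rlfCofinal_of_mulEquiv e (PiNat.isPerfFactorialWeak' (J := Z.Cusp ⊕ Z.Comp))
    (PiNat.rlf_cofinal' (J := Z.Cusp ⊕ Z.Comp)) Z.isPerfFactorialWeak_DIVplus

/-! ### `Div⁺(Z^log_∞)` inside `DIV⁺(Z^log_∞)`: group-saturated and perf-dense (Def. 3.1 (i), Prop. 3.2 (i)) -/

/-- **`Div⁺(Z^log_∞)` is GROUP-SATURATED in `DIV⁺(Z^log_∞)`** ([EtTh] §0 `IsGroupSaturated`, for the submonoid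
`Div⁺ ∩ DIV⁺` of `DIV⁺`): a quotient `q = a·b⁻¹ ∈ DIV⁺` of Cartier effective log-divisors is Cartier (`Div` is a
subgroup of `DIV`) and effective. [cite: MochizukiEtTh2009, Def 3.1 p.70] -/
theorem isGroupSaturated_Divplus_comap : IsGroupSaturated (Z.Divplus.comap Z.DIVplus.subtype) := by
  rw [isGroupSaturated_iff']
  intro q a ha b hb h
  rw [Submonoid.mem_comap] at ha hb ⊢
  have hq : (q : Z.DIV) = (a : Z.DIV) * (b : Z.DIV)⁻¹ := by
    rw [eq_mul_inv_iff_mul_eq, ← Submonoid.coe_mul, h]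
  refine ⟨?_, q.2⟩
  show (q : Z.DIV) ∈ Z.Div.toSubmonoid
  rw [hq]
  exact Z.Div.mul_mem (Z.Divplus_le_Div ha) (Z.Div.inv_mem (Z.Divplus_le_Div hb))

/-- **`Div⁺(Z^log_∞)` is PERF-DENSE in `DIV⁺(Z^log_∞)`** — Prop. 3.2 (i): "`n · DIV⁺(Z^log_∞) ⊆ Div⁺(Z^log_∞)`",
i.e. the perf-saturation of `Div⁺ ∩ DIV⁺` in `DIV⁺` is everything. [cite: MochizukiEtTh2009, Prop 3.2 p.70] -/
theorem mem_perfSaturation_Divplus_comap (x : ↥Z.DIVplus) :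
    x ∈ perfSaturation (Z.Divplus.comap Z.DIVplus.subtype) := by
  obtain ⟨n, hn⟩ := Z.exists_pow_mem_Divplus
  rw [mem_perfSaturation_iff]
  refine ⟨n, ?_⟩
  rw [Submonoid.mem_comap, Submonoid.coe_subtype, SubmonoidClass.coe_pow]
  exact hn _ x.2

/-- `Div⁺(Z^log_∞) ∩ DIV⁺(Z^log_∞) = Div⁺(Z^log_∞)` as monoids (`Div⁺ ⊆ DIV⁺`). [cite: MochizukiEtTh2009, Def 3.1 p.70] -/
theorem nonempty_divplusComapEquiv : Nonempty (↥(Z.Divplus.comap Z.DIVplus.subtype) ≃* ↥Z.Divplus) :=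
  ⟨{ toFun := fun x => ⟨(x.1 : Z.DIV), x.2⟩
     invFun := fun y => ⟨⟨y.1, Z.Divplus_le_DIVplus y.2⟩, y.2⟩
     left_inv := fun _ => rfl
     right_inv := fun _ => rfl
     map_mul' := fun _ _ => rfl }⟩

/-- `Div⁺(Z^log_∞) ∩ DIV⁺(Z^log_∞)` is weakly perf-factorial (engine `GroupSaturatedSubmonoid.isPerfFactorialWeak`).
[cite: MochizukiEtTh2009, Prop 3.4 p.74] -/
theorem isPerfFactorialWeak_Divplus_comap : IsPerfFactorialWeak ↥(Z.Divplus.comap Z.DIVplus.subtype) :=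
  GroupSaturatedSubmonoid.isPerfFactorialWeak Z.isPerfFactorialWeak_DIVplus Z.isZMonoprime_submonoid_primes_DIVplus
    Z.isGroupSaturated_Divplus_comap Z.mem_perfSaturation_Divplus_comap

/-! ### Prop. 3.4 (i) for `Div⁺(Z^log_∞)` -/

/-- **`Div⁺(Z^log_∞)` is weakly perf-factorial** ([EtTh] Prop. 3.4 (i) "is perf-factorial", weak reading;
"follows immediately from Proposition 3.2, (i)"). [cite: MochizukiEtTh2009, Prop 3.4 p.74] -/
theorem isPerfFactorialWeak_Divplus : IsPerfFactorialWeak ↥Z.Divplus := by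
  obtain ⟨e⟩ := Z.nonempty_divplusComapEquiv
  exact Z.isPerfFactorialWeak_Divplus_comap.of_mulEquiv e

/-- **Every prime component `Div⁺(Z^log_∞)_𝔭 ≅ ℤ≥0` is `ℤ`-monoprime** (the primes of `Div⁺(Z^log_∞)` are those of
`DIV⁺(Z^log_∞)`, i.e. the cusps and the irreducible components of the special fibre, Rmk. 3.3.1; `Div⁺_𝔭` is the
submonoid of multiples of the least Cartier multiple). [cite: MochizukiEtTh2009, Rmk 3.3.1 p.73] -/
theorem isZMonoprime_submonoid_primes_Divplus (𝔭 : Primes ↥Z.Divplus) : IsZMonoprime ↥𝔭.submonoid := by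
  obtain ⟨e⟩ := Z.nonempty_divplusComapEquiv
  exact (GroupSaturatedSubmonoid.isZMonoprime_submonoid_primes Z.isPerfFactorialWeak_DIVplus.isDivisorial.isSharp
      Z.isZMonoprime_submonoid_primes_DIVplus Z.isGroupSaturated_Divplus_comap Z.mem_perfSaturation_Divplus_comap
      (Primes.congr e.symm 𝔭)).of_mulEquiv
    (Primes.submonoidCongr e (Primes.congr e.symm 𝔭) 𝔭 (Primes.congr_apply_congr_symm e 𝔭))

/-- **(d_cof) for `Div⁺(Z^log_∞)`**: "for every `a ∈ M^rlf` there exists `a' ∈ M^pf` with `a' ≥ a`" ([EtTh] p. 75),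
descended from `DIV⁺` along `Div⁺^pf ≅ DIV⁺^pf` (Prop. 3.2 (i)). [cite: MochizukiEtTh2009, Lem 3.5 p.75] -/
theorem rlfCofinal_Divplus :
    ∀ x : Z.isPerfFactorialWeak_Divplus.Rlf, ∃ b : Perfection ↥Z.Divplus,
      x ∣ Z.isPerfFactorialWeak_Divplus.toRealification b := by
  obtain ⟨e⟩ := Z.nonempty_divplusComapEquiv
  exact IsPerfFactorialWeak.rlfCofinal_of_mulEquiv e Z.isPerfFactorialWeak_Divplus_comap
    (GroupSaturatedSubmonoid.rlfCofinal Z.isPerfFactorialWeak_DIVplus Z.rlfCofinal_DIVplus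
      Z.mem_perfSaturation_Divplus_comap Z.isPerfFactorialWeak_Divplus_comap)
    Z.isPerfFactorialWeak_Divplus

/-- **`Div⁺(Z^log_∞)` is weakly perf-factorial WITH COFINAL PERFECTION** (`IsPerfFactorialCof`, the cell's reading
of "perf-factorial" for [EtTh] §3 after F-L2d2-1/F-L2d2-2). [cite: MochizukiEtTh2009, Prop 3.4 p.74] -/
theorem isPerfFactorialCof_Divplus : IsPerfFactorialCof ↥Z.Divplus :=
  ⟨Z.isPerfFactorialWeak_Divplus, Z.rlfCofinal_Divplus⟩

/-- **[EtTh] Prop. 3.4 (i) for `Div⁺(Z^log_∞)`, IN THE WEAK VOCABULARY OF RECORD**: "each of the monoids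
`Div⁺(Z^log_∞)` … appearing in the inductive limit defining `Φ₀(Y^log)` is perf-factorial" read with
`treeMonoidVocabWeak` (perf-factorial := `IsPerfFactorialCof`), for every `LogDivisorModel` — by the printed route
"follows immediately from Proposition 3.2, (i)".  The printed [FrdI] Def. 2.4 (i)(d) reading is refuted for
infinite index sets (F-L2d2-1); the Galois-invariant members and the limit `Φ₀(Y^log)` are not treated here.
[cite: MochizukiEtTh2009, Prop 3.4 p.74] -/
theorem prop34_i_Divplus : treeMonoidVocabWeak.IsPerfFactorial ↥Z.Divplus :=
  (treeMonoidVocabWeak_isPerfFactorial _).mpr Z.isPerfFactorialCof_Divplus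

end LogDivisorModel

end Literature.AnabelianGeometry.EtaleTheta

end
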